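import Mathlib
import Summits.KontsevichZagierPeriods.Zeta5Search.ClusterValuation
import Summits.KontsevichZagierPeriods.Zeta5Search.PalindromicClassBounds
import Summits.KontsevichZagierPeriods.Zeta5Search.PalindromicClassBoundsProof
import Summits.KontsevichZagierPeriods.Zeta5Search.CasoratianClassBoundProof
import Summits.KontsevichZagierPeriods.Zeta5Search.DenomLaw.ThresholdModelRho
import Summits.KontsevichZagierPeriods.Zeta5Search.RecordCellAAtlasNotMin

/-!
# ζ(5) search — DENOM-LAW: the threshold model, PART V (the Casoratian on the D region), part A: helpers, `ν_x` versus `E_x`, low pairs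

Cell `pub-zeta5`, track DENOM-LAW (K1 typing order item (1), «ThresholdModel port»): denom-engine-d2 g15's kernel-checked scratch module
`denom-law/engine-d2/g15/lean/LevelCensusCasoratian.lean` PART V (THRESHOLD-X7) filed VERBATIM in three parts (≤ 400 lines each) by denom-prover-d1 g5.  Part A of 3 (= 18th file of the port).
HONEST FRAMING: systematic search; MODEL-side level combinatorics read against the tree's own `casLB`/`vbMin`/`rowMin` (THEOREM LB) on deep cells; nothing about ζ(5); no γ; no irrationality claim; records in print UNMOVED.
The mathematical header of PART V is the second module docstring of part A (`ThresholdModelCasoratian.lean`).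
-/

namespace Summit.KontsevichZagierPeriods.Zeta5Search.DenomLaw.ThresholdModel.Rho

/-! # PART V — THE CASORATIAN ON THE D REGION: THEOREM LB (`ClusterValuationPairs.casLB`, proved in
`CasoratianClassBoundProof`) and the (CV) law's right-hand side `refund − pairFloors` (`CasoratianValuation`) in closed form;
(CV) on deep cells of octave `m ≥ 2` is a consequence of THEOREM LB (denom-engine-d2 g15, scratch typing; NOT a tree filing)

HONEST FRAMING: as Parts I–IV — MODEL/structure side, elementary integer bookkeeping read against the tree's own computable
objects; no linear form is evaluated, no p-adic digit, no kernel VALUE of any form; the valuation statements at the end are the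
TREE'S ALREADY-PROVED THEOREMS (`casoratianClassBound_holds` = THEOREM LB, `wLB_le_padicValRat_coeffW`, `uLB_le_padicValRat_coeffU`,
`vbMin_le_padicValRat_coeffV`, `palindromicClassBoundW_holds` / `…U_holds`) with their right-hand sides rewritten in closed form
on a deep cell — nothing new is proved about any valuation; nothing about ζ(5); no γ; no irrationality claim; records in print UNMOVED.

THE TREE'S OBJECTS (`Zeta5Search/ClusterValuationPairs.lean` §3e, `CasoratianValuation.lean`):
`classNu b p x = if classPoleCount = 1 ∧ tameSingle then max E_x 0 else E_x` (`ν_x`), `vbMin b p = min over pole classes of ν_x`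
(`VB(b,p)`, an `Option ℤ`), `rowMin b p = min{1 [single-pole class], 3 + E_x [multipole class], 0 [p > d]}` (an `Option ℤ`),
`casLB b p = VB + rowMin` (`LB(b,p)`; `0` if there is no pole class); `pairFloors b p = Σ_{i<k} ⌊(b₀ − b_i − b_k)/p⌋` (`N_p`),
`refund b p = min 1 ⌊d(b)/p⌋`, `dOf b = 3b₀ − Σ b_j`; the OBSERVED law (CV) `CasoratianValuationLaw`:
`v_p(Cas_j(b)) ≥ refund − pairFloors` for window primes; THEOREM LB (`CasoratianClassBound`, PROVED by
`casoratianClassBound_holds`): `v_p(Cas_j(b)) ≥ casLB b p`.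

## What is proved here (kernel-checked), for every DEEP tree cell `b` (Part I's `BCell` at `q = (m−1)p`, octave `m ≥ 1`, odd
`p ≥ 3`) with a dominant class `u₀` (one always exists, `DeepCell.exists_dominant`), writing `E_min := score(u₀) − (4m+8)` (the
common `E_x` of the dominant classes, Part IV `classExp_vs_dominant`) and `π(ρ) := #{j < k : ρ_j + ρ_k ≥ 2p}` (`pairHigh`, the
number of pair blocks of the UPPER digit `m`):
* (X7-1) `classExp_le_classNu` (= the tree's `CellA.classExp_le_classNu`, re-exported), `classNu_of_multipole`: `ν_x ≥ E_x` always, `ν_x = E_x` on a multipole class.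
* (X7-2) **`vbMin_of_deep`: `VB(b,p) = some E_min`** — the dominant classes (m+1 ≥ 2 poles, minimal `E_x`) realise the minimum of `ν`.
* (X7-3) **`rowMin_of_deep`: `rowMin b p = some (3 + E_min)`** (`rowMin` is `classRowList b p 3` of rung M plus the refund entry:
  `rowMin_eq_classRowList`; Part IV's `minRow_eq`).
* (X7-4) **`casLB_of_deep`: `LB(b,p) = 2·E_min + 3 = 2·score(u₀) − 8m − 13`**, i.e. **`casLB = vbMin + wLB`** (`casLB_eq_wLB_add`):
  on the D region THEOREM LB is the PRODUCT of the `V`-floor and rung M for `W`, term by term — no cross credit.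
* (X7-5) **`dOf_of_deep`**: `2·d(b) = Σ_j ρ_j − R₀ + (4m−5)p` and **`d(b) ≥ p + 2`** on every deep cell (from `ρ₁+ρ₅ ≥ 2p`,
  `ρ₂+ρ₄ ≥ 2p`, `ρ₅, ρ₆, ρ₇ ≥ p`, `ρ₃ ≥ 1`, `R₀ ≤ 3p−2`); hence **`refund_of_deep`: `refund b p = 1`** and the refund entries of
  `wLB` / `rowMin` are absent (`p ≤ d < d + 1`).
* (X7-6) **`pairFloors_of_deep`: `N_p = pairFloors b p = 21(m−1) + π(ρ)`** (each pair digit is `m−1` or `m`; `ediv_two_window`),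
  and on a deep cell **`DeepCell.pairHigh_eq`: `π(ρ) = 17 + [ρ₁+ρ₂ ≥ 2p] + [ρ₁+ρ₃ ≥ 2p] + [ρ₁+ρ₄ ≥ 2p] + [ρ₂+ρ₃ ≥ 2p]`** (the anchors
  `ρ₁+ρ₅ ≥ 2p`, `ρ₂+ρ₄ ≥ 2p` force the other 17 pairs), so `17 ≤ π ≤ 21` (`pairHigh_bounds`), `π ≤ 20 ⇒ ρ₁+ρ₂ < 2p`, `π = 17 ⇒
  ρ₁+ρ₄ < 2p ∧ ρ₂+ρ₃ < 2p` (`π = 21 − |λ|` in the deep type's pair-deficiency `λ`).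
* (X7-7) **LOW PAIRS FORCE FRAME ROOTS** (`two_le_LR_of_lowPair`, `four_le_LR_of_twoLowPairs`; sortedness only): `ρ₁+ρ₂ < 2p ⇒
  L(u)+R(u) ≥ 2` for EVERY class `u`, and `ρ₁+ρ₄ < 2p ∧ ρ₂+ρ₃ < 2p ⇒ L(u)+R(u) ≥ 4` (a low pair `ρ_j+ρ_k < p−u + p+u` puts `ρ_j` below
  `p−u` or `ρ_k` below `p+u`, and disjoint pairs add); hence **`DeepCell.twentyone_le_pairHigh_add_two_score`:
  `π(ρ) + 2·score(u) ≥ 21` for every class of a deep cell, with equality only if `π = 21 ∧ score(u) = 0`**, and therefore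
  **`casLB_sub_cv_of_deep`: `LB − (refund − N_p) = 13m + π(ρ) + 2·score(u₀) − 35`**, **`cv_add_le_casLB_of_deep`:
  `refund − N_p + (13m − 14) ≤ LB` on every deep cell** — equality exactly on the cells with all 21 pair digits equal to `m` and a
  dominant class of score `0` (no root at `±m/2, ±3m/2`: two full poles of order 6 — the «pure» cells); for `m ≥ 2` the slack over
  (CV) is `≥ 12`, at `m = 1` THEOREM LB is `≥ (CV) − 1`, and `≥ (CV)` unless `(π, score_min) = (21, 0)` (`cv_le_casLB_of_deep_m_one`).
* (X7-8) **THE TREE'S PROVED VALUATION BOUNDS READ ON A DEEP CELL** (window prime `p ≥ 5`, `p² > b₀ + 2`, `b` (and `b + e_j`) in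
  the Brown–Zudilin polytope, the coefficient / Casoratian nonzero — exactly the hypotheses of the tree theorems):
  `v_p(V(b)) ≥ E_min` (`padicValRat_coeffV_ge_of_deep`), `v_p(W(b)) ≥ 3 + E_min` and `+1` more when every dominant class fires
  the palindrome bonus (`padicValRat_coeffW_ge_of_deep`, `…_pal`), `v_p(U(b)) ≥ 5 + E_min` (+1) (`padicValRat_coeffU_ge_of_deep`,
  `…_pal`), **`v_p(Cas_j(b)) ≥ 2·E_min + 3 = 2·score(u₀) − 8m − 13`** (`padicValRat_casoratian_ge_of_deep`), and
  **`casoratianValuationLaw_of_deep`: `refund − N_p + (13m − 14) ≤ v_p(Cas_j(b))` on EVERY deep cell** — so the OBSERVED law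
  (CV) (`CasoratianValuationLaw`, `@[conjecture]` in the tree) restricted to the D region is a THEOREM of the tree from octave 2 on
  (with `12` to spare, `casoratianValuationLaw_of_deep_two_le`) and at octave 1 on every deep cell that is not «pure»
  (`casoratianValuationLaw_of_deep_m_one`); on the pure octave-1 cells THEOREM LB stops exactly one unit short of (CV)
  (there (CV) needs a cancellation between the leading digits of `V` and `W`, or LB is not attained).
* (X7-9) **THE PURE CELLS** (`score_eq_zero_iff`, `DeepCell.exists_score_zero_iff`, `isDominant_of_score_zero`): a class of score `0` (no root at
  `±m/2, ±3m/2`, off-centre) exists on a deep cell — and is then dominant, `score_min = 0`, `π = 21` — iff **`ρ₁ ≥ p + ε ∧ R₀ ≤ 2p − 1 − ε`,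
  `ε = 1 (R₀ odd) / 2 (R₀ even)`** (witness `u = ε`), i.e. `2·b_max ≤ b₀ − m·p − ε ∧ b₀ ≤ 3m·p − 1 − ε`: all seven lower parameters at least
  `(p + ε)/2` below `b₀/2 − (m−1)p/2` — the «thin» cells with seven long blocks.  These are exactly the cells where LB = (CV) + 13m − 14.
Kernel examples (`decide` on the tree's definitions): `palCell = (30; 12,9,9,7,7,7,7)` at `p = 11` (`m = 1`, `E_min = −10`, `π = 19`,
`score_min = 2`): `vbMin = some (−10)`, `rowMin = some (−7)`, `casLB = −17`, `pairFloors = 19`, `dOf = 32`, `refund = 1`,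
`LB − CV = 1 = 13 + 19 + 4 − 35`; its octave-2 image `σ₁ palCell = (63; 23,20,20,18,18,18,18)`: `casLB = −25`, `pairFloors = 40`,
`refund = 1`, `LB − CV = 14 = 26 + 19 + 4 − 35`; and a deep `m = 1` cell on which THEOREM LB is SHORT of (CV):
`pureCell = (20; 4,4,4,4,4,4,4)` at `p = 11` (`ρ = (12,…,12)`, `R₀ = 9`, all 21 pairs high `π = 21`, dominant classes `u = ±1` of
score `0` — two full poles of order `6`, `E_min = −12`): `casLB = −21 < −20 = refund − N_p` (`π + 2·score_min − 21 = 0`), so at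
octave 1 the observed (CV) is NOT a corollary of LB on the pure cells (there (CV) needs a cancellation between the leading digits
of `V` and `W`, or LB is not attained); `pureCell` IS a `BCell` (by `decide`), so `m ≥ 2` / «not pure» cannot be dropped.
Numerical companion: `denom-law/code/d2g15/caslb15.py` recomputes `classNu / vbMin / rowMin / casLB / pairFloors / dOf / refund`
from the tree's definitions by integer membership and `score`, `π` from Parts I/V on g10's (1,11) design block + the eight
exhaustive deep blocks + F2 (258,706 cells) and checks (X7-2)–(X7-7) cell by cell (258,706 / 258,706), with the `(π, score_min)` table at `m = 1`: the thirteen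
occurring types are `(17,4)`, `(18,2..4)`, `(19,2..4)`, `(20,2..3)`, `(21,0..3)` — `π + 2·score_min − 21 ∈ {0,…,6}`, `0` exactly on
the 2,345 pure cells `(21,0)` of the 123,349 octave-1 cells (1.9 %).
-/

section Casoratian

open Summit.KontsevichZagierPeriods.Zeta5Search.ClusterValuation (classExp classPoleCount classNu tameSingle vbMin rowMin casLB
  classRowList wLB uLB wLBpal uLBpal casoratianClassBound_holds wLB_le_padicValRat_coeffW uLB_le_padicValRat_coeffU
  vbMin_le_padicValRat_coeffV palindromicClassBoundW_holds palindromicClassBoundU_holds)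
open Summit.KontsevichZagierPeriods.Zeta5Search.CasoratianValuation (InPolytope pairFloors refund shift casoratian)
open Summit.KontsevichZagierPeriods.Zeta5Search.WedgeDictionary (dOf coeffW coeffU coeffV)

/-! ### Pure helpers: `min?` of integer lists, integer division in a digit window, sums over the 21 pairs -/

section PureV

/-- `min?` of a nonempty integer list is `some` of its default reading. -/
theorem min?_eq_some_getD {l : List ℤ} (hne : l ≠ []) : l.min? = some ((l.min?).getD 0) := by
  cases h : l.min? with
  | none => exact absurd (List.min?_eq_none_iff.1 h) hne
  | some v => rfl

/-- `min?` of an integer list with a least element that belongs to it. -/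
theorem min?_eq_some_of_least {l : List ℤ} {v : ℤ} (hv : v ∈ l) (hle : ∀ z ∈ l, v ≤ z) : l.min? = some v := by
  cases h : l.min? with
  | none => rw [List.min?_eq_none_iff] at h; rw [h] at hv; simp at hv
  | some m' =>
    have h1 := List.min?_eq_some_iff.1 h
    exact congrArg some (le_antisymm (h1.2 v hv) (hle m' h1.1))

/-- integer division inside a digit window (integer modulus; file-local — the general form is Mathlib's `Int.le_ediv_iff_mul_le` /
`Int.ediv_lt_iff_lt_mul`). -/
private theorem ediv_eq_of_window_int {t p k : ℤ} (hp : 0 < p) (h1 : k * p ≤ t) (h2 : t < (k + 1) * p) : t / p = k := by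
  have a : k ≤ t / p := (Int.le_ediv_iff_mul_le hp).2 h1
  have b : t / p < k + 1 := (Int.ediv_lt_iff_lt_mul hp).2 h2
  omega

/-- the Legendre DIGIT of a form `t` at a natural prime (or any natural) `p`: inside the window `k·p ≤ t < (k+1)·p` one has `t / p = k`
(the form in which every digit computation of the DENOM-LAW files uses it: `p : ℕ` cast to `ℤ`, `k` the digit `0` or `1`). -/
theorem ediv_eq_of_window {t k : ℤ} {p : ℕ} (hp : (0 : ℤ) < p) (h1 : k * (p : ℤ) ≤ t) (h2 : t < (k + 1) * (p : ℤ)) :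
    t / (p : ℤ) = k :=
  ediv_eq_of_window_int hp h1 h2

/-- the pair digit in the two-digit window `(m−1)p ≤ t ≤ (m−1)p + 2p − 1`: `⌊t/p⌋ = (m − 1) + [t ≥ m·p]`. -/
theorem ediv_two_window {t p m : ℤ} (hp : 0 < p) (h1 : (m - 1) * p ≤ t) (h2 : t ≤ (m - 1) * p + 2 * p - 1) :
    t / p = (m - 1) + indic (m * p ≤ t) := by
  by_cases h : m * p ≤ t
  · rw [indic_pos h]
    exact ediv_eq_of_window_int hp (by nlinarith) (by nlinarith)
  · rw [indic_neg h]
    have := ediv_eq_of_window_int (k := m - 1) hp h1 (by nlinarith)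
    omega

/-- there are 21 pairs `j < k` in `Fin 7`. -/
theorem sum_pairs_const (c : ℤ) : (∑ j : Fin 7, ∑ k : Fin 7, if j < k then c else 0) = 21 * c := by
  simp only [Fin.sum_univ_seven]
  simp only [Fin.lt_def]
  norm_num
  ring

/-- splitting a constant off a pair sum. -/
theorem sum_pairs_add (c : ℤ) (f : Fin 7 → Fin 7 → ℤ) :
    (∑ j : Fin 7, ∑ k : Fin 7, if j < k then c + f j k else 0) =
      21 * c + ∑ j : Fin 7, ∑ k : Fin 7, if j < k then f j k else 0 := by
  have e : ∀ j k : Fin 7, (if j < k then c + f j k else 0) = (if j < k then c else 0) + (if j < k then f j k else 0) := by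
    intro j k; split_ifs <;> simp
  simp only [e, Finset.sum_add_distrib, sum_pairs_const]

/-- `range 7` double sums are `Fin 7` double sums. -/
theorem sum_range_seven_sq (g : ℕ → ℕ → ℤ) :
    (∑ i ∈ Finset.range 7, ∑ k ∈ Finset.range 7, g i k) = ∑ j : Fin 7, ∑ k : Fin 7, g j k := by
  rw [Finset.sum_range]
  refine Finset.sum_congr rfl fun j _ => ?_
  rw [Finset.sum_range]

end PureV

/-! ### (X7-1) `ν_x` versus `E_x` -/

/- `ν_x ≥ E_x` for every class: this is the tree's `CellA.classExp_le_classNu` (`RecordCellAAtlasNotMin`), re-exported under this namespace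
so that the DENOM-LAW files keep their short name for it (no restatement). -/
export Summit.KontsevichZagierPeriods.Zeta5Search.CellA (classExp_le_classNu)

/-- `ν_x = E_x` on a class with at least two poles. -/
theorem classNu_of_multipole {b : ℕ → ℤ} {p x : ℕ} (h2 : 2 ≤ classPoleCount b p x) : classNu b p x = classExp b p x := by
  unfold classNu; rw [if_neg (by rintro ⟨h1, -⟩; omega)]

/-- `rowMin` is the rung-M row list `classRowList b p 3` with the refund entry `0 [p > d]` (definitional). -/
theorem rowMin_eq_classRowList (b : ℕ → ℤ) (p : ℕ) :
    rowMin b p = (classRowList b p 3 ++ (if dOf b < (p : ℤ) then [0] else [])).min? := rfl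

/-- the pair count `π(ρ) = #{j < k : ρ_j + ρ_k ≥ 2p}` = the number of pair blocks `b₀ − b_j − b_k` with the UPPER digit `m`. -/
def pairHigh (p : ℤ) (r : Fin 7 → ℤ) : ℤ := ∑ j : Fin 7, ∑ k : Fin 7, if j < k then indic (2 * p ≤ r j + r k) else 0

/-- the dominance score is nonnegative (a sum of counts and indicators). -/
theorem score_nonneg (p R0 : ℤ) (r : Fin 7 → ℤ) (u : ℤ) : 0 ≤ score p R0 r u := by
  unfold score delta L R np nm centre
  have h1 := countLt_nonneg r (u + p)
  have h2 := countLt_nonneg r (p - u)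
  have h3 := indic_nonneg (2 * p - R0 ≤ u)
  have h4 := indic_nonneg (u ≤ R0 - 2 * p)
  have h5 := indic_nonneg (u = 0 ∨ u = p)
  linarith

/-! ### (X7-7, combinatorial half) low pairs force frame roots: `L + R` from below (sortedness only) -/

section LowPairs
variable {p : ℤ} {r : Fin 7 → ℤ}

/-- `L(−u) + R(−u) = L(u) + R(u)` (the mirror swaps the two counts). -/
theorem LR_neg (p : ℤ) (r : Fin 7 → ℤ) (u : ℤ) : L p r (-u) + R p r (-u) = L p r u + R p r u := by
  unfold L R
  rw [show -u + p = p - u by ring, show p - -u = u + p by ring]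
  ring

/-- the frame roots are part of the score: `L(u) + R(u) ≤ score(u)`. -/
theorem LR_le_score (p R0 : ℤ) (r : Fin 7 → ℤ) (u : ℤ) : L p r u + R p r u ≤ score p R0 r u := by
  unfold score delta np nm centre
  have h3 := indic_nonneg (2 * p - R0 ≤ u)
  have h4 := indic_nonneg (u ≤ R0 - 2 * p)
  have h5 := indic_nonneg (u = 0 ∨ u = p)
  linarith

/-- **ONE LOW PAIR ⇒ TWO FRAME ROOTS**: if `ρ₁ + ρ₂ < 2p` then `L(u) + R(u) ≥ 2` for EVERY `u` (then `ρ₁ < p`; either `ρ₁ < p − |u|`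
counts twice, or `p + |u| ≥ 2p − ρ₁ > ρ₂` counts `ρ₁, ρ₂` on one side). -/
theorem two_le_LR_of_lowPair (hr : Monotone r) (h01 : r 0 + r 1 < 2 * p) (u : ℤ) : 2 ≤ L p r u + R p r u := by
  have m01 : r 0 ≤ r 1 := hr (by decide)
  have hr0 : r 0 < p := by linarith
  have e1 : (((1 : Fin 7) : ℕ) : ℤ) = 1 := by decide
  -- the case `v ≥ 0`
  have key : ∀ v : ℤ, 0 ≤ v → 2 ≤ L p r v + R p r v := by
    intro v hv
    have hL1 : 1 ≤ L p r v := by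
      have := countLt_ge hr 0 (show r 0 < v + p by linarith); unfold L; simpa using this
    by_cases hv2 : v < p - r 0
    · have hR1 : 1 ≤ R p r v := by
        have := countLt_ge hr 0 (show r 0 < p - v by linarith); unfold R; simpa using this
      linarith
    · have hL2 : 2 ≤ L p r v := by
        have := countLt_ge hr 1 (show r 1 < v + p by linarith); unfold L
        rw [e1] at this; linarith
      have := countLt_nonneg r (p - v)
      unfold R; linarith
  rcases le_or_gt 0 u with hu | hu
  · exact key u hu
  · have := key (-u) (by linarith); rwa [LR_neg] at this

/-- **TWO DISJOINT LOW PAIRS ⇒ FOUR FRAME ROOTS**: if `ρ₁ + ρ₄ < 2p` and `ρ₂ + ρ₃ < 2p` then `L(u) + R(u) ≥ 4` for every `u`. -/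
theorem four_le_LR_of_twoLowPairs (hr : Monotone r) (h03 : r 0 + r 3 < 2 * p) (h12 : r 1 + r 2 < 2 * p) (u : ℤ) :
    4 ≤ L p r u + R p r u := by
  have m01 : r 0 ≤ r 1 := hr (by decide)
  have m12 : r 1 ≤ r 2 := hr (by decide)
  have m23 : r 2 ≤ r 3 := hr (by decide)
  have e1 : (((1 : Fin 7) : ℕ) : ℤ) = 1 := by decide
  have e2 : (((2 : Fin 7) : ℕ) : ℤ) = 2 := by decide
  have e3 : (((3 : Fin 7) : ℕ) : ℤ) = 3 := by decide
  have key : ∀ v : ℤ, 0 ≤ v → 4 ≤ L p r v + R p r v := by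
    intro v hv
    have hRnn := countLt_nonneg r (p - v)
    by_cases h3 : r 3 < v + p
    · -- all of ρ₁..ρ₄ lie below `p + v`
      have hL := countLt_ge hr 3 h3; rw [e3] at hL
      unfold L R; linarith
    · -- `ρ₄ ≥ p + v`, so `ρ₁ < p − v`
      have hr0 : r 0 < p - v := by linarith
      by_cases h2 : r 2 < v + p
      · have hL := countLt_ge hr 2 h2; rw [e2] at hL
        have hR := countLt_ge hr 0 hr0
        unfold L R; simp at hR; linarith
      · -- `ρ₃ ≥ p + v`, so `ρ₂ < p − v ≤ p + v`
        have hr1 : r 1 < p - v := by linarith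
        have hL := countLt_ge hr 1 (show r 1 < v + p by linarith); rw [e1] at hL
        have hR := countLt_ge hr 1 hr1; rw [e1] at hR
        unfold L R; linarith
  rcases le_or_gt 0 u with hu | hu
  · exact key u hu
  · have := key (-u) (by linarith); rwa [LR_neg] at this

end LowPairs

end Casoratian

end Summit.KontsevichZagierPeriods.Zeta5Search.DenomLaw.ThresholdModel.Rho
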